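import Summits.Ventures.LatticeQCDFlow.Scoring.SU2CharacterExpansion
import Literature.Analysis.FunctionSpaces.BesselIIntegralSeries
import HarnessLib

/-!
# SU(2): the Wilson plaquette weight as an absolutely convergent CHARACTER SERIES `e^{−2β(1−a₀)} = Σ_n c_n(β)·U_n(a₀)`, Haar-a.e., with `Σ_n (n+1)·c_n(β) < ∞`

HONEST FRAMING: exact (Metropolis-corrected) sampling algorithms for lattice gauge theory;
figures of merit are autocorrelation/cost numbers at stated couplings and volumes; no
continuum-physics claim.

Venture `LatticeQCDFlow` (cell pub-lqcd), sub-topic `Scoring`; FANOUT row 5 (`s0-sun-a`), GEN-9.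
NEW WORK of the cell (placement rule).  First input of the LATTICE ASSEMBLY (step 6) of row 5's
route to the exact SU(2) torus formula: the per-plaquette expansion that is summed under the
Haar integral over `G^E`, with the domination needed for Fubini.

* `su2CharCoeff`-free bookkeeping: the coefficient is written out,
  `c_n(β) = e^{−2β}·(I_n(2β) − I_{n+2}(2β))` (`SU2CharacterExpansion.haar_su2_character_expect`'s
  numerator); `charCoeff_nonneg` (`β ≥ 0`, Bessel monotonicity `besselI_antitone`).
* **`hasSum_charCoeff_mul_chebyshevU`** — for `|a₀(U)| < 1`:
  `Σ_n c_n(β)·U_n(a₀(U)) = e^{−β(2 − 2a₀(U))}` (the Wilson weight of theory-2 at `N = 2`).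
* `haar_abs_su2a0_eq_one` — the exceptional set `{|a₀| = 1} = {±1}` is Haar-null (semicircle law).
* `abs_chebyshevU_eval_le` — `|U_n(t)| ≤ n + 1` on `[−1, 1]`.
* **`summable_succ_mul_charCoeff`** — `Σ_n (n+1)·c_n(β) < ∞` (from `I_n(x) ≤ (x/2)^n/n!·I_0(x)`),
  hence the termwise domination `|c_n U_n(a₀)| ≤ (n+1) c_n` is summable uniformly in `U`.

No new definition; nothing cited (folklore / DLMF-level facts already in the tree).
-/

noncomputable section

open Real MeasureTheory Set Polynomial.Chebyshev
open Literature.MathematicalPhysics.QuantumFieldTheory Literature.MathematicalPhysics.QuantumLattice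
open Literature.Analysis.FunctionSpaces
open Summit.Ventures.LatticeQCDFlow.Exactness

namespace Summit.Ventures.LatticeQCDFlow.Scoring

/-! ## §1. The coefficients -/

/-- `c_n(β) = e^{−2β}(I_n(2β) − I_{n+2}(2β)) ≥ 0` for `β ≥ 0`. -/
theorem charCoeff_nonneg {β : ℝ} (hβ : 0 ≤ β) (n : ℕ) :
    0 ≤ Real.exp (-(2 * β)) * (besselI n (2 * β) - besselI (n + 2) (2 * β)) := by
  refine mul_nonneg (Real.exp_nonneg _) (sub_nonneg.mpr ?_)
  exact besselI_antitone (by linarith) (by omega)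

/-- `c_n(β) ≤ e^{−2β} I_n(2β)` for `β ≥ 0`. -/
theorem charCoeff_le {β : ℝ} (hβ : 0 ≤ β) (n : ℕ) :
    Real.exp (-(2 * β)) * (besselI n (2 * β) - besselI (n + 2) (2 * β)) ≤
      Real.exp (-(2 * β)) * besselI n (2 * β) := by
  refine mul_le_mul_of_nonneg_left ?_ (Real.exp_nonneg _)
  linarith [besselI_nonneg (n + 2) (show 0 ≤ 2 * β by linarith)]

/-! ## §2. The pointwise character series of the plaquette weight -/

/-- **The Wilson weight as a character series**: for `U ∈ SU(2)` with `|a₀(U)| < 1`,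
`Σ_n e^{−2β}(I_n(2β) − I_{n+2}(2β))·U_n(a₀(U)) = e^{−β(2 − 2a₀(U))}`. -/
theorem hasSum_charCoeff_mul_chebyshevU (β : ℝ) (V : Matrix.specialUnitaryGroup (Fin 2) ℂ)
    (hV : |su2a0 V| < 1) :
    HasSum (fun n : ℕ => Real.exp (-(2 * β)) * (besselI n (2 * β) - besselI (n + 2) (2 * β)) *
        (U ℝ n).eval (su2a0 V)) (Real.exp (-(β * (2 - 2 * su2a0 V)))) := by
  have hlt := abs_lt.mp hV
  have hcos : Real.cos (Real.arccos (su2a0 V)) = su2a0 V := Real.cos_arccos hlt.1.le hlt.2.le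
  have hsin : Real.sin (Real.arccos (su2a0 V)) ≠ 0 := by
    rw [Real.sin_arccos]
    have : 0 < 1 - su2a0 V ^ 2 := by nlinarith [hlt.1, hlt.2]
    exact (Real.sqrt_pos.mpr this).ne'
  have h := (hasSum_besselI_sub_mul_chebyshevU (2 * β) hsin).mul_left (Real.exp (-(2 * β)))
  rw [hcos] at h
  have e : Real.exp (-(2 * β)) * Real.exp (2 * β * su2a0 V) = Real.exp (-(β * (2 - 2 * su2a0 V))) := by
    rw [← Real.exp_add]; ring_nf
  rw [e] at h
  refine h.congr_fun fun n => ?_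
  ring

/-- The exceptional set is Haar-null: `Haar{|a₀| = 1} = 0` (the semicircle law has a density). -/
theorem haar_abs_su2a0_eq_one :
    haarProbability (Matrix.specialUnitaryGroup (Fin 2) ℂ)
      {V : Matrix.specialUnitaryGroup (Fin 2) ℂ | |su2a0 V| = 1} = 0 := by
  have hset : {V : Matrix.specialUnitaryGroup (Fin 2) ℂ | |su2a0 V| = 1} = su2a0 ⁻¹' {1, -1} := by
    ext V
    simp only [mem_setOf_eq, mem_preimage, mem_insert_iff, mem_singleton_iff]
    constructor
    · intro h
      rcases abs_eq (zero_le_one) |>.mp h with h1 | h1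
      · exact Or.inl h1
      · exact Or.inr h1
    · rintro (h | h) <;> simp [h]
  have hfin : ({1, -1} : Set ℝ).Finite := by simp
  rw [hset, ← Measure.map_apply continuous_su2a0.measurable hfin.measurableSet, map_su2a0_haarProbability,
    semicircleLaw]
  exact withDensity_absolutelyContinuous _ _ (hfin.measure_zero volume)

/-- **Haar-a.e. form** of the character series. -/
theorem hasSum_charCoeff_mul_chebyshevU_ae (β : ℝ) :
    ∀ᵐ V ∂(haarProbability (Matrix.specialUnitaryGroup (Fin 2) ℂ)),
      HasSum (fun n : ℕ => Real.exp (-(2 * β)) * (besselI n (2 * β) - besselI (n + 2) (2 * β)) *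
        (U ℝ n).eval (su2a0 V)) (Real.exp (-(β * (2 - 2 * su2a0 V)))) := by
  rw [ae_iff]
  refine measure_mono_null (fun V hV => ?_) haar_abs_su2a0_eq_one
  simp only [mem_setOf_eq] at hV ⊢
  by_contra h
  exact hV (hasSum_charCoeff_mul_chebyshevU β V (lt_of_le_of_ne (abs_su2a0_le_one V) h))

/-! ## §3. Domination -/

/-- `|sin((n+1)θ)| ≤ (n+1)|sin θ|`. -/
theorem abs_sin_succ_mul_le (n : ℕ) (θ : ℝ) :
    |Real.sin (((n : ℝ) + 1) * θ)| ≤ ((n : ℝ) + 1) * |Real.sin θ| := by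
  induction n with
  | zero => simp
  | succ n ih =>
    push_cast
    have e : Real.sin (((n : ℝ) + 1 + 1) * θ) =
        Real.sin (((n : ℝ) + 1) * θ) * Real.cos θ + Real.cos (((n : ℝ) + 1) * θ) * Real.sin θ := by
      rw [← Real.sin_add]; ring_nf
    rw [e]
    have h1 : |Real.sin (((n : ℝ) + 1) * θ) * Real.cos θ| ≤ ((n : ℝ) + 1) * |Real.sin θ| := by
      rw [abs_mul]
      exact (mul_le_of_le_one_right (abs_nonneg _) (Real.abs_cos_le_one θ)).trans ih
    have h2 : |Real.cos (((n : ℝ) + 1) * θ) * Real.sin θ| ≤ |Real.sin θ| := by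
      rw [abs_mul]
      exact mul_le_of_le_one_left (abs_nonneg _) (Real.abs_cos_le_one _)
    calc |Real.sin (((n : ℝ) + 1) * θ) * Real.cos θ + Real.cos (((n : ℝ) + 1) * θ) * Real.sin θ|
        ≤ |Real.sin (((n : ℝ) + 1) * θ) * Real.cos θ| + |Real.cos (((n : ℝ) + 1) * θ) * Real.sin θ| :=
          abs_add_le _ _
      _ ≤ ((n : ℝ) + 1) * |Real.sin θ| + |Real.sin θ| := add_le_add h1 h2
      _ = ((n : ℝ) + 1 + 1) * |Real.sin θ| := by ring

/-- **`|U_n(t)| ≤ n + 1` on `[−1, 1]`.** -/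
theorem abs_chebyshevU_eval_le (n : ℕ) {t : ℝ} (ht : |t| ≤ 1) : |(U ℝ n).eval t| ≤ (n : ℝ) + 1 := by
  have hle := abs_le.mp ht
  -- interior: t = cos θ with sin θ ≠ 0; boundary by continuity… simpler: boundary values explicitly
  rcases lt_or_eq_of_le ht with hlt | heq
  · have hlt' := abs_lt.mp hlt
    set θ := Real.arccos t with hθ
    have hcos : Real.cos θ = t := Real.cos_arccos hlt'.1.le hlt'.2.le
    have hsinpos : 0 < Real.sin θ := by
      rw [hθ, Real.sin_arccos]
      exact Real.sqrt_pos.mpr (by nlinarith [hlt'.1, hlt'.2])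
    have h := chebyshevU_eval_cos_mul_sin n θ
    rw [hcos] at h
    have hb := abs_sin_succ_mul_le n θ
    rw [← h, abs_mul, abs_of_pos hsinpos] at hb
    exact le_of_mul_le_mul_right hb hsinpos
  · rcases (abs_eq zero_le_one).mp heq with h1 | h1
    · rw [h1, chebyshevU_eval_one_nat, abs_of_nonneg (by positivity)]
    · rw [h1, U_eval_neg, chebyshevU_eval_one_nat, abs_mul, ← Int.cast_abs, Int.abs_negOnePow, Int.cast_one,
        one_mul, abs_of_nonneg (by positivity)]

/-- **`Σ_n (n+1)·e^{−2β} I_n(2β) < ∞`** for `β ≥ 0` (from `I_n(x) ≤ (x/2)^n/n!·I_0(x)`). -/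
theorem summable_succ_mul_exp_mul_besselI {β : ℝ} (hβ : 0 ≤ β) :
    Summable fun n : ℕ => ((n : ℝ) + 1) * (Real.exp (-(2 * β)) * besselI n (2 * β)) := by
  have h2β : 0 ≤ 2 * β := by linarith
  -- dominate by (n+1) β^n/n! · (e^{-2β} I_0(2β))
  have hdom : ∀ n : ℕ, ((n : ℝ) + 1) * (Real.exp (-(2 * β)) * besselI n (2 * β)) ≤
      (Real.exp (-(2 * β)) * besselI 0 (2 * β)) * (((n : ℝ) + 1) * (β ^ n / (Nat.factorial n))) := by
    intro n
    have h := besselI_le_pow_div_factorial_mul n h2β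
    rw [show (2 * β) / 2 = β by ring] at h
    have hpos : 0 ≤ ((n : ℝ) + 1) * Real.exp (-(2 * β)) := by positivity
    calc ((n : ℝ) + 1) * (Real.exp (-(2 * β)) * besselI n (2 * β))
        = (((n : ℝ) + 1) * Real.exp (-(2 * β))) * besselI n (2 * β) := by ring
      _ ≤ (((n : ℝ) + 1) * Real.exp (-(2 * β))) * (β ^ n / (Nat.factorial n) * besselI 0 (2 * β)) :=
          mul_le_mul_of_nonneg_left h hpos
      _ = (Real.exp (-(2 * β)) * besselI 0 (2 * β)) * (((n : ℝ) + 1) * (β ^ n / (Nat.factorial n))) := by ring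
  have hnn : ∀ n : ℕ, 0 ≤ ((n : ℝ) + 1) * (Real.exp (-(2 * β)) * besselI n (2 * β)) := fun n => by
    have := besselI_nonneg n h2β; positivity
  refine Summable.of_nonneg_of_le hnn hdom ((Summable.mul_left _ ?_))
  -- Σ (n+1) β^n/n! converges (exponential series and its derivative)
  have h1 : Summable fun n : ℕ => β ^ n / (Nat.factorial n) := Real.summable_pow_div_factorial β
  have h2 : Summable fun n : ℕ => (n : ℝ) * (β ^ n / (Nat.factorial n)) := by
    -- n β^n/n! = β · β^(n-1)/(n-1)! for n ≥ 1
    refine (summable_nat_add_iff 1).mp ?_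
    have e : (fun n : ℕ => (((n + 1 : ℕ) : ℝ)) * (β ^ (n + 1) / (Nat.factorial (n + 1) : ℝ))) =
        fun n : ℕ => β * (β ^ n / (Nat.factorial n : ℝ)) := by
      funext n
      rw [Nat.factorial_succ, pow_succ]
      push_cast
      have hn : ((n : ℝ) + 1) ≠ 0 := by positivity
      have hf : ((Nat.factorial n : ℕ) : ℝ) ≠ 0 := by positivity
      field_simp
    rw [e]
    exact (Real.summable_pow_div_factorial β).mul_left β
  have e3 : (fun n : ℕ => ((n : ℝ) + 1) * (β ^ n / (Nat.factorial n))) =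
      fun n : ℕ => (n : ℝ) * (β ^ n / (Nat.factorial n)) + β ^ n / (Nat.factorial n) := by
    funext n; ring
  rw [e3]
  exact h2.add h1

/-- **Summable domination of the character series**, uniformly on SU(2): for `β ≥ 0`,
`|c_n(β)·U_n(a₀(V))| ≤ (n+1)·e^{−2β} I_n(2β)`, a summable sequence independent of `V`. -/
theorem abs_charCoeff_mul_chebyshevU_le {β : ℝ} (hβ : 0 ≤ β) (V : Matrix.specialUnitaryGroup (Fin 2) ℂ)
    (n : ℕ) :
    |Real.exp (-(2 * β)) * (besselI n (2 * β) - besselI (n + 2) (2 * β)) * (U ℝ n).eval (su2a0 V)| ≤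
      ((n : ℝ) + 1) * (Real.exp (-(2 * β)) * besselI n (2 * β)) := by
  rw [abs_mul, abs_of_nonneg (charCoeff_nonneg hβ n), mul_comm]
  exact mul_le_mul (abs_chebyshevU_eval_le n (abs_su2a0_le_one V)) (charCoeff_le hβ n) (charCoeff_nonneg hβ n)
    (by positivity)

/-- **`Σ_n (n+1)·c_n(β) < ∞`** for `β ≥ 0`. -/
theorem summable_succ_mul_charCoeff {β : ℝ} (hβ : 0 ≤ β) :
    Summable fun n : ℕ => ((n : ℝ) + 1) *
      (Real.exp (-(2 * β)) * (besselI n (2 * β) - besselI (n + 2) (2 * β))) := by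
  refine Summable.of_nonneg_of_le (fun n => ?_) (fun n => ?_) (summable_succ_mul_exp_mul_besselI hβ)
  · exact mul_nonneg (by positivity) (charCoeff_nonneg hβ n)
  · exact mul_le_mul_of_nonneg_left (charCoeff_le hβ n) (by positivity)

end Summit.Ventures.LatticeQCDFlow.Scoring
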